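import Summits.QuantumFields.YangMills.Theses.SmallCircleAnchor

/-!
# `OneLayerAnchor` is the `T = 1` instance of `AnchorGap` (route `SmallCircleAnchor` of `YangMills`)

Support item `stmt-QuantumFields-11143`
(`Summit.QuantumFields.YangMills.Theses.SmallCircleAnchor.OneLayerAnchor`): for every compact simple
`G` and faithful unitary lattice representation `r` there is an abelianising class-function pinning
`V` (minimum set one conjugacy class `Cl(g₀)` with `C_G(g₀)` abelian) such that the ONE-time-layer
pinned Wilson theory on `ℤ₁ × (ℤ/L)³` — Borgs–Seiler's one-layer model, i.e. three-dimensional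
lattice `G`-gauge theory with a `G`-valued adjoint Higgs `u_x` pinned to `Cl(g₀)` by `E(β) V(u_x)`,
the lattice Georgi–Glashow model in its abelianising regime — clusters exponentially in space,
uniformly in the spatial volume, for all `β ≥ β₀` (Polyakov 1977 made rigorous).

This file records the machine-checked reduction stated in the route text ("implied by AnchorGap
by instantiation"): the crux `AnchorGap` (stmt-QuantumFields-11141) quantifies over every temporal
extent `T ≥ 1` (`∀ (T : ℕ) [NeZero T]`), and its body at `T := 1` is, up to proof-irrelevant
instance arguments, literally the body of `OneLayerAnchor`; the deformation `V` is the same.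

Sources: A. M. Polyakov, Nucl. Phys. B 120 (1977) 429; C. Borgs, E. Seiler, Commun. Math. Phys. 91
(1983) 329, §III.1 (the one-layer model); M. Ünsal, L. G. Yaffe, Phys. Rev. D 78 (2008) 065035
(arXiv:0803.0344).
-/

namespace Summit.QuantumFields.YangMills.Theorems

open Summit.QuantumFields.YangMills.Theses.SmallCircleAnchor

/-- **`AnchorGap → OneLayerAnchor`** (route `SmallCircleAnchor`, support item
stmt-QuantumFields-11143 from crux stmt-QuantumFields-11141): the one-layer anchor is the
temporal-extent-`T = 1` instance of the anchor gap, with the same abelianising deformation `V`.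
Proof: instantiate `∀ (T : ℕ) [NeZero T]` at `T := 1`. -/
theorem oneLayerAnchor_of_anchorGap (h : AnchorGap) : OneLayerAnchor := by
  intro G _ _ _ _ hG r
  obtain ⟨V, hV, hanch⟩ := h G hG r
  exact ⟨V, hV, hanch 1⟩

end Summit.QuantumFields.YangMills.Theorems
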